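import Summits.BirchSwinnertonDyer.BirchSwinnertonDyer.Theorems.SylvesterTwoHeegnerIndexYinDefs
import HarnessLib

/-!
# Yin 2026 (arXiv:2607.01744, PREPRINT), Thm. 1.1 + display (3.5.3): the single-curve
# Gross–Zagier display `L′(E_p, 1)/Ω = 2^{δ}·ĥ_ℚ(Z_p)` with `c₃ = 2^{−δ}`, `c_p = 3`, `#tors = 3`
# — ONE claim-level named hypothesis (`_PRE`) in EXACTLY the shape of the route leaf
# `SylvesterTwoYin.YinHeightDisplay`, and the by-name bridge

Cross-ladder LITERATURE-TYPING layer (D-0088(4)), cell `bsd-littype`, ASSIGNMENTS.tsv row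
**ASK-CM-01** (from `bsd-cm-plan` g21, REQUESTS 2026-08-27T03:06:06Z; taken by seat `bsd-littype-06`
gen 4 as an idle typer): the `K7t` route `SylvesterTwoHeegnerIndex` (item 19804, line variant D,
`pub/bsd-cm/STATUS.md` 03:06:06Z) consumes the display as the stub hypothesis
`(hY : SylvesterTwoYin.YinHeightDisplay)` of the pure `@[conjecture]` leaf
`Summits/BirchSwinnertonDyer/BirchSwinnertonDyer/Theorems/SylvesterTwoHeegnerIndexYinDefs.lean`
(p476378; importable from `Literature/` because it declares nothing but `@[conjecture] def`s). This
file gives that hypothesis a LITERATURE-SIDE name carrying the source, its locators and its print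
status — `Yin2026.thm11_heightDisplay_PRE`, body VERBATIM the leaf's — and the bridge
`Yin2026.yinHeightDisplay_of_thm11_PRE : thm11_heightDisplay_PRE → SylvesterTwoYin.YinHeightDisplay`
(definitional, `Iff.rfl`), so that the stub is discharged BY NAME from a tagged claim binder. It is a
CLAIM of an UNREFEREED 2026 preprint (companion of arXiv:2605.25917, whose non-torsion theorem it
quotes), typed as a HYPOTHESIS of the tree and never discharged here; the tree's two other Yin 2026
binders (`Yin2026/CubeSumCMPoints.lean`: `exists_not_isOfFinAddOrder_cubeSumCurve`,
`deriv_entireLFunction_one_ne_zero_cubeSumCurve`) are untouched and not restated (this one is the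
HEIGHT IDENTITY with its `2`-power, which they do not carry).

## The source, verbatim (materialised text `paper:arxiv-2607.01744`, v1, 2 Jul 2026, 23 pp.)

* p. 1 (p0001 L24–L37): "we will use the elliptic curve `E_{p^i} : y² = x³ + p^{2i}/4` which is
  isogenious to `y² = x³ − 432p^{2i}` over `ℚ`. Let `K = ℚ(√−3)` … `φ : X₁(N) → E_{ϖ̄^i}` … where
  `N = 9p` or `27p` depending on `p^i ≡ 4` or `7` modulo `9`" (`i = 1, 2`).
* Thm. 1.1 (p0002 L11–L24): "by the result of [Yin], `ϕ∘φ(τ_r) ∈ E_{p^i}(K)` is a non-torsion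
  point. Let `Ω_{p^i}` be the Neron periods of `E_{p^i}` and `ĥ_ℚ` be the Neron–Tate height with
  base field `ℚ` … **Theorem 1.1.** We have `L′(E_{p^i}, 1)/Ω_{p^i} = 2^{δ(p^i)} ĥ_ℚ(ϕ∘φ(τ_r))`
  where `δ(p^i) = 0`, `p^i ≡ 4 mod 9`; `−1`, `p^i ≡ 7 mod 9`."
* (3.5.2)–(3.5.3) and the Tamagawa table (p0011 L49–L58, p0012 L1–L10): "By [Ste68, section 5],
  the local Tamagawa numbers of `E_{p^i}` are … `c_v = 1` (`v ∣ 3`, `p^i ≡ 4 mod 9`), `2`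
  (`v ∣ 3`, `p^i ≡ 7 mod 9`), `3` (`v ∣ p`), `1` (`v ∤ 3p`)"; "Since `|E_{p^i}(ℚ)_tor| = 3`, the
  BSD conjecture … predicts that (3.5.3) `L′(E_{p^i},1)/Ω_{p^i} = 2^{−δ(p^i)} Ш(E_{p^i}) ĥ_ℚ(P)/3`,
  where `P` is the generator of `E_{p^i}(ℚ)`. Then (3.5.2) together with (3.5.3) predict that
  `[√−3]φ(τ_r)` is usually the generator or twice the generator (depending on `N = 9p` or `27p`)
  of `E_{p^i}(ℚ)` if `Ш(E_{p^i}) = 1`."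

## What is typed, and what is weaker than print

`thm11_heightDisplay_PRE` is the leaf's reading of Thm. 1.1 + (3.5.3) at `i = 1` (the curve
`x³ + y³ = p` only — WEAKER than print, which also covers `p²`), on a globally minimal `ℚ`-model `B`
of the tree's `cubeSumCurve p` (`Y² = X³ − 432p²`, `ℚ`-isogenous to Yin's model), in the tree's
currency: `#Ш_an(B) = shaAn B = qB ∈ ℚ^×` (Miller's analytic order), `rank B(K) = 2` over a quadratic
`K ∋ ω`, a rational generator `P` modulo torsion (in `ι`-form `QuadraticDescent.incl`), a point
`Y ∈ B(K)` (print: `Y = ψ([√−3]·ϕ∘φ(τ_r))`) and a rational `2`-ADIC UNIT `u` (print: a power of `3`,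
from the `3`-isogeny between the models) with `(u·qB)·ĥ_K(ιP) = 2^{2δ}·ĥ_K(Y)`. The passage from
the printed `L′/Ω`-identity to this `Ш_an`-form is the leaf's (MEMO bsd-cm-two v2.9 §46; docstring of
`SylvesterTwoYin.YinHeightDisplay`) and is recorded, not re-derived, here: the binder is BY DESIGN
the same proposition as the leaf, so that nothing is asserted twice in two shapes.

## References

* [Yin2026SylvesterGrossZagier] H. Yin, *Gross–Zagier formula for the 4, 7 cases of Sylvester's
  conjecture*, arXiv:2607.01744v1 (2 Jul 2026), Thm. 1.1 (p. 2), (3.5.2)–(3.5.3) (pp. 11–12).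
  PREPRINT, unrefereed (2026-08-27: no journal, no DOI).
* [Yin2026SylvesterFourSeven] H. Yin, arXiv:2605.25917v3, Thm. 8.6 (the non-torsion CM point).
* Route leaf: `Summits/…/Theorems/SylvesterTwoHeegnerIndexYinDefs.lean` (p476378), MEMO bsd-cm-two
  v2.8 §42 / v2.9 §46.
-/

set_option autoImplicit false

noncomputable section

open scoped Classical

open WeierstrassCurve WeierstrassCurve.Affine WeierstrassCurve.Affine.Point
  Literature.NumberTheory.EllipticCurves Literature.NumberTheory.EllipticCurves.HuShuYin2019

namespace Literature.NumberTheory.EllipticCurves.Yin2026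

/-- **Yin, arXiv:2607.01744v1, Thm. 1.1 with (3.5.3) — CLAIMED, UNREFEREED PREPRINT (2026); a
hypothesis of the tree, never discharged; body VERBATIM the route leaf `SylvesterTwoYin.YinHeightDisplay`.**
For every prime `p ≡ 4, 7 (mod 9)` and every globally minimal `B ≅ E_p` (`C • B = cubeSumCurve p`),
over every quadratic number field `K ∋ ω` (`ω² + ω + 1 = 0`): `#Ш_an(B) = qB ≠ 0` is rational,
`rank_ℤ B(K) = 2`, and there are a rational point `P` (non-torsion, generating `B(ℚ)` modulo torsion,
in `ι`-form), a point `Y ∈ B(K)` and a rational `2`-adic unit `u` with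
`(u·qB)·ĥ_K(ι P) = 2^{2δ}·ĥ_K(Y)`, `2δ = 0 | −2` for `p ≡ 4 | 7 (mod 9)`. Print: "**Theorem 1.1.** We
have `L′(E_{p^i}, 1)/Ω_{p^i} = 2^{δ(p^i)} ĥ_ℚ(ϕ∘φ(τ_r))`, `δ(p^i) = 0 | −1` for `p^i ≡ 4 | 7 mod 9`"
(p. 2), "`ϕ∘φ(τ_r) ∈ E_{p^i}(K)` is a non-torsion point" (ibid., from arXiv:2605.25917), and (3.5.3)
with "`|E_{p^i}(ℚ)_tor| = 3`", `c₃ = 2^{−δ}`, `c_p = 3` (pp. 11–12); read at `i = 1` on the tree's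
model (weaker than print, which also covers `p²`).
[claim: Yin2026SylvesterGrossZagier, status: under-review]
[cite: Yin2026SylvesterGrossZagier, Thm. 1.1 (v1 p. 2) and (3.5.2)–(3.5.3) (pp. 11–12)] -/
def thm11_heightDisplay_PRE : Prop :=
  ∀ (p : ℕ), p.Prime → (p % 9 = 4 ∨ p % 9 = 7) →
    ∀ (B : WeierstrassCurve ℚ) [B.IsElliptic] [B.IsGloballyMinimal],
      (∃ C : VariableChange ℚ, C • B = cubeSumCurve (p : ℚ)) →
    ∀ (K : Type) [Field K] [NumberField K] (ω : K), ω ^ 2 + ω + 1 = 0 → Module.finrank ℚ K = 2 →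
      ∃ qB : ℚ, shaAn B = (qB : ℂ) ∧ qB ≠ 0 ∧ (B.baseChange K).mordellWeilRank = 2 ∧
        ∃ (P : B.toAffine.Point) (Y : (B.baseChange K).toAffine.Point) (u : ℚ),
          u ≠ 0 ∧ padicValRat 2 u = 0 ∧
          ¬ IsOfFinAddOrder (QuadraticDescent.incl K B P) ∧
          (∀ Q : B.toAffine.Point, ∃ m : ℤ,
            IsOfFinAddOrder (QuadraticDescent.incl K B Q - m • QuadraticDescent.incl K B P)) ∧
          ((u * qB : ℚ) : ℝ) * canonicalHeight (QuadraticDescent.incl K B P) =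
            (2 : ℝ) ^ (if p % 9 = 4 then (0 : ℤ) else -2) * canonicalHeight Y

/-- **The bridge, by name**: Yin's claimed display IS the route leaf's hypothesis shape
`SylvesterTwoYin.YinHeightDisplay` (definitionally). [claim: Yin2026SylvesterGrossZagier, status: under-review]
[cite: Yin2026SylvesterGrossZagier, Thm. 1.1 (v1 p. 2) and (3.5.3) (p. 12)] -/
theorem thm11_heightDisplay_PRE_iff :
    thm11_heightDisplay_PRE ↔
      Summit.BirchSwinnertonDyer.BirchSwinnertonDyer.Theorems.SylvesterTwoYin.YinHeightDisplay :=
  Iff.rfl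

/-- **`thm11_heightDisplay_PRE → SylvesterTwoYin.YinHeightDisplay`** — discharges the stub `hY` of
the `K7t` line (item 19804, variant D) by name from the claim binder; CONDITIONAL on the claim,
nothing asserted. [claim: Yin2026SylvesterGrossZagier, status: under-review]
[cite: Yin2026SylvesterGrossZagier, Thm. 1.1 (v1 p. 2) and (3.5.3) (p. 12)] -/
theorem yinHeightDisplay_of_thm11_PRE (h : thm11_heightDisplay_PRE) :
    Summit.BirchSwinnertonDyer.BirchSwinnertonDyer.Theorems.SylvesterTwoYin.YinHeightDisplay :=
  h

end Literature.NumberTheory.EllipticCurves.Yin2026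

end
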